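import Literature.Geometry.Lorentzian.CoordSigma2Linearization
import Literature.Geometry.Lorentzian.CoordCurvatureLaplacianSymmetries
import Literature.Geometry.Lorentzian.CoordShrinkerRicciLaplacian
import HarnessLib

/-!
# Huisken's projection estimate `|∇Ric|² ≥ (3n−2)/(2(n−1)(n+2)) |∇S|²` in coordinates

Support file (theorems only) for Hamilton 1982, §11 (the gradient estimate for the scalar
curvature along the Ricci flow, Thm. 11.1 / Lemma 11.6), used by the crux `ChangGurskyYang` of the
route `SmoothPoincare4/EntropyRung` (item `stmt-SmoothPoincare4-10834`, line
`margerin-cone-hamilton-rails`, stub `stub_gradientEstimates`).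

In the chart framework of `CoordCurvature.lean` / `CoordBianchi.lean` (metric components
`G : E → (E →L E →L ℝ)`, `IsMetricOn G V`, covariant derivative `cov₂At` of a field of bilinear
forms, metric pairing `pairAt`, gradient square `gradSqAt`, scalar curvature `scalAt`, Ricci form
`ricAt`) we prove, at a point `x ∈ V` where `G x` is positive definite:

* `sum_mul_tracePattern`, `sum_tracePattern_diag₂₃`, `sum_tracePattern_diag₁₂` — the Kronecker
  algebra of the pattern tensor `a(δ_{ij}v_k + δ_{ik}v_j) + c δ_{jk}v_i` against a tensor
  `t_{ijk}`, symmetric in `(j,k)`, with prescribed traces `Σ_j t_{ijj} = w_i`, `Σ_i t_{iik} = w_k/2`;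
* **`sum_sq_traces_le`** — the algebraic core of Huisken 1985, Lemma 4.3 / Hamilton 1982,
  Lemma 11.6: for such `t` with `w = v`,
  `(3n−2)/(2(n−1)(n+2)) Σ_i v_i² ≤ Σ_{ijk} t_{ijk}²` (`n = |ι|`), by expanding
  `0 ≤ Σ (N t − P)²` for the optimal pattern `P` (`N = 2(n−1)(n+2)`);
* `IsMetricOn.covNormSq_ricAt_eq_sum_frame` — `|∇Ric|²_x = Σ_{kl} g^{kl} ⟨∇_{b_k}Ric, ∇_{b_l}Ric⟩_G`
  (any basis `b`) is `Σ_{cij} ((∇_{e_c}Ric)(e_i,e_j))²` in a `G x`-orthonormal frame `e`;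
* **`IsMetricOn.mul_gradSqAt_scalAt_le_covNormSq_ricAt`** — Huisken 1985, Lemma 4.3 (Hamilton
  1982, Lemma 11.6 for `n = 3`): `(3n−2)/(2(n−1)(n+2)) |∇S|²_x ≤ |∇Ric|²_x`
  `= Σ_{kl} g^{kl} ⟨∇_{b_k}Ric, ∇_{b_l}Ric⟩_G` (`n = dim E`, any basis `b`), from the two trace
  identities `tr_G(∇_Y Ric) = dS(Y)` (`IsMetricOn.fderiv_scalAt_eq_mtrAt`) and the contracted
  Bianchi identity `dS = 2 div Ric` (`IsMetricOn.fderiv_scalAt'`), read in a `G x`-orthonormal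
  frame (`exists_orthonormal_basis`).

Everything is proved; no definition and no statement of `Prop` type is introduced.

## References

* R. S. Hamilton, *Three-manifolds with positive Ricci curvature*, J. Differential Geom. 17
  (1982) 255–306, §§7, 10, 11 (Lemma 11.6, Thm. 11.1). [Hamilton1982]
* G. Huisken, *Ricci deformation of the metric on a Riemannian manifold*, J. Differential Geom. 21
  (1985) 47–62, §4, Lemma 4.3. [Huisken1985]
* B. O'Neill, *Semi-Riemannian geometry with applications to relativity*, Academic Press 1983,
  Ch. 3 (Cor. 3.54, pp. 60–61, 85–88). [ONeill1983]
* P. Topping, *Lectures on the Ricci flow*, LMS Lecture Note Series 325, CUP 2006, §2.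
  [Topping2006]
-/

noncomputable section

set_option maxSynthPendingDepth 3

open Set Filter ContinuousLinearMap Module
open scoped Topology ContDiff

namespace Literature.Geometry.Lorentzian

namespace MetricCoord

/-! ### Kronecker algebra of the trace patterns -/

section Algebra

variable {ι : Type*} [Fintype ι] [DecidableEq ι]

/-- **Pairing a `(j,k)`-symmetric tensor with the trace pattern**: if `Σ_j t_{ijj} = w_i` and
`Σ_i t_{iik} = w_k / 2`, then
`Σ_{ijk} t_{ijk} (a(δ_{ij}v_k + δ_{ik}v_j) + c δ_{jk}v_i) = (a + c) Σ_i w_i v_i`.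
[cite: Huisken1985, Lemma 4.3] -/
theorem sum_mul_tracePattern (t : ι → ι → ι → ℝ) (v w : ι → ℝ) (a c : ℝ)
    (hsym : ∀ i j k, t i j k = t i k j) (h₁ : ∀ i, ∑ j, t i j j = w i)
    (h₂ : ∀ k, ∑ i, t i i k = w k / 2) :
    ∑ i, ∑ j, ∑ k, t i j k * (a * ((if i = j then v k else 0) + (if i = k then v j else 0))
        + c * (if j = k then v i else 0)) = (a + c) * ∑ i, w i * v i := by
  -- the three Kronecker contractions
  have hA : ∑ i, ∑ j, ∑ k, t i j k * (if i = j then v k else 0) =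
      ∑ k, (∑ i, t i i k) * v k := by
    calc ∑ i, ∑ j, ∑ k, t i j k * (if i = j then v k else 0)
        = ∑ i, ∑ k, ∑ j, t i j k * (if i = j then v k else 0) :=
          Finset.sum_congr rfl fun i _ ↦ Finset.sum_comm
      _ = ∑ i, ∑ k, t i i k * v k := by
          simp only [mul_ite, mul_zero, Finset.sum_ite_eq, Finset.mem_univ, if_true]
      _ = ∑ k, (∑ i, t i i k) * v k := by
          rw [Finset.sum_comm]
          exact Finset.sum_congr rfl fun k _ ↦ by rw [Finset.sum_mul]
  have hB : ∑ i, ∑ j, ∑ k, t i j k * (if i = k then v j else 0) =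
      ∑ j, (∑ i, t i i j) * v j := by
    calc ∑ i, ∑ j, ∑ k, t i j k * (if i = k then v j else 0)
        = ∑ i, ∑ j, t i i j * v j := by
          simp only [mul_ite, mul_zero, Finset.sum_ite_eq, Finset.mem_univ, if_true]
          exact Finset.sum_congr rfl fun i _ ↦ Finset.sum_congr rfl fun j _ ↦ by rw [hsym i j i]
      _ = ∑ j, (∑ i, t i i j) * v j := by
          rw [Finset.sum_comm]
          exact Finset.sum_congr rfl fun j _ ↦ by rw [Finset.sum_mul]
  have hC : ∑ i, ∑ j, ∑ k, t i j k * (if j = k then v i else 0) =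
      ∑ i, (∑ j, t i j j) * v i := by
    simp only [mul_ite, mul_zero, Finset.sum_ite_eq, Finset.mem_univ, if_true]
    exact Finset.sum_congr rfl fun i _ ↦ by rw [Finset.sum_mul]
  have hhalf : ∑ k, (∑ i, t i i k) * v k = (∑ i, w i * v i) / 2 := by
    rw [Finset.sum_div]
    exact Finset.sum_congr rfl fun k _ ↦ by rw [h₂ k]; ring
  have hfull : ∑ i, (∑ j, t i j j) * v i = ∑ i, w i * v i :=
    Finset.sum_congr rfl fun i _ ↦ by rw [h₁ i]
  have hexp : ∀ i j k, t i j k * (a * ((if i = j then v k else 0) + (if i = k then v j else 0))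
      + c * (if j = k then v i else 0)) = a * (t i j k * (if i = j then v k else 0))
        + a * (t i j k * (if i = k then v j else 0)) + c * (t i j k * (if j = k then v i else 0)) := by
    intro i j k; ring
  simp only [hexp, Finset.sum_add_distrib, ← Finset.mul_sum]
  rw [hA, hB, hC, hhalf, hfull]
  ring

/-- The `(2,3)`-trace of the pattern tensor: `Σ_j P_{ijj} = (2a + n c) v_i`. [folklore] -/
theorem sum_tracePattern_diag₂₃ (v : ι → ℝ) (a c : ℝ) (i : ι) :
    ∑ j, (a * ((if i = j then v j else 0) + (if i = j then v j else 0))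
        + c * (if j = j then v i else 0)) = (2 * a + Fintype.card ι * c) * v i := by
  simp only [Finset.sum_add_distrib, ← Finset.mul_sum, Finset.sum_ite_eq, Finset.mem_univ,
    if_true, Finset.sum_const, Finset.card_univ, nsmul_eq_mul]
  ring

/-- The `(1,2)`-trace of the pattern tensor: `Σ_i P_{iik} = ((n + 1) a + c) v_k`. [folklore] -/
theorem sum_tracePattern_diag₁₂ (v : ι → ℝ) (a c : ℝ) (k : ι) :
    ∑ i, (a * ((if i = i then v k else 0) + (if i = k then v i else 0))
        + c * (if i = k then v i else 0)) = ((Fintype.card ι + 1) * a + c) * v k := by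
  simp only [Finset.sum_add_distrib, ← Finset.mul_sum, Finset.sum_ite_eq', Finset.mem_univ,
    if_true, Finset.sum_const, Finset.card_univ, nsmul_eq_mul]
  ring

/-- **The algebraic core of Huisken 1985, Lemma 4.3 / Hamilton 1982, Lemma 11.6**: if `t_{ijk}` is
symmetric in `(j,k)` with `Σ_j t_{ijj} = v_i` and `Σ_i t_{iik} = v_k/2`, then
`(3n−2)/(2(n−1)(n+2)) Σ_i v_i² ≤ Σ_{ijk} t_{ijk}²` (`n = |ι|`; for `n ≤ 1` the left side is `0`
by the conventions `x/0 = 0` resp. the empty sum). Proof: `0 ≤ Σ (N t − P)²` with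
`N = 2(n−1)(n+2)` and the pattern `P = (n−2)(δ_{ij}v_k + δ_{ik}v_j) + 2n δ_{jk}v_i`, for which
`Σ t P = (3n−2)|v|²` and `Σ P² = N(3n−2)|v|²`. [cite: Huisken1985, Lemma 4.3] -/
theorem sum_sq_traces_le (t : ι → ι → ι → ℝ) (v : ι → ℝ)
    (hsym : ∀ i j k, t i j k = t i k j) (h₁ : ∀ i, ∑ j, t i j j = v i)
    (h₂ : ∀ k, ∑ i, t i i k = v k / 2) :
    (3 * (Fintype.card ι : ℝ) - 2) /
          (2 * ((Fintype.card ι : ℝ) - 1) * ((Fintype.card ι : ℝ) + 2)) * ∑ i, v i ^ 2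
      ≤ ∑ i, ∑ j, ∑ k, t i j k ^ 2 := by
  obtain ⟨n, hn⟩ : ∃ n : ℝ, n = (Fintype.card ι : ℝ) := ⟨_, rfl⟩
  rw [← hn]
  have hsq : 0 ≤ ∑ i, ∑ j, ∑ k, t i j k ^ 2 :=
    Finset.sum_nonneg fun i _ ↦ Finset.sum_nonneg fun j _ ↦
      Finset.sum_nonneg fun k _ ↦ sq_nonneg _
  -- the pattern tensor
  obtain ⟨P, hP⟩ : ∃ P : ι → ι → ι → ℝ, ∀ i j k, P i j k =
      (n - 2) * ((if i = j then v k else 0) + (if i = k then v j else 0))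
        + 2 * n * (if j = k then v i else 0) := ⟨_, fun _ _ _ ↦ rfl⟩
  have hPsym : ∀ i j k, P i j k = P i k j := by
    intro i j k
    rw [hP, hP, add_comm (if i = j then v k else 0)]
    rcases eq_or_ne j k with rfl | hjk
    · rfl
    · rw [if_neg hjk, if_neg hjk.symm]
  have hP₁ : ∀ i, ∑ j, P i j j = 2 * (n - 1) * (n + 2) * v i := by
    intro i
    rw [Finset.sum_congr rfl fun j _ ↦ hP i j j, sum_tracePattern_diag₂₃, ← hn]
    ring
  have hP₂ : ∀ k, ∑ i, P i i k = 2 * (n - 1) * (n + 2) * v k / 2 := by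
    intro k
    rw [Finset.sum_congr rfl fun i _ ↦ hP i i k, sum_tracePattern_diag₁₂, ← hn]
    ring
  -- `Σ t P = (3n − 2) |v|²`
  have htP : ∑ i, ∑ j, ∑ k, t i j k * P i j k = (3 * n - 2) * ∑ i, v i * v i := by
    rw [Finset.sum_congr rfl fun i _ ↦ Finset.sum_congr rfl fun j _ ↦
      Finset.sum_congr rfl fun k _ ↦ by rw [hP i j k],
      sum_mul_tracePattern t v v (n - 2) (2 * n) hsym h₁ h₂]
    ring
  -- `Σ P² = N (3n − 2) |v|²`
  have hPP : ∑ i, ∑ j, ∑ k, P i j k * P i j k =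
      (3 * n - 2) * ∑ i, (2 * (n - 1) * (n + 2) * v i) * v i := by
    rw [Finset.sum_congr rfl fun i _ ↦ Finset.sum_congr rfl fun j _ ↦
      Finset.sum_congr rfl fun k _ ↦ by nth_rewrite 2 [hP i j k]; rfl,
      sum_mul_tracePattern P v (fun i ↦ 2 * (n - 1) * (n + 2) * v i) (n - 2) (2 * n)
        hPsym hP₁ hP₂]
    ring
  have hvv : ∑ i, (2 * (n - 1) * (n + 2) * v i) * v i =
      2 * (n - 1) * (n + 2) * ∑ i, v i ^ 2 := by
    rw [Finset.mul_sum]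
    exact Finset.sum_congr rfl fun i _ ↦ by ring
  have hv2 : ∑ i, v i * v i = ∑ i, v i ^ 2 := Finset.sum_congr rfl fun i _ ↦ by ring
  -- `0 ≤ Σ (N t − P)² = N² |t|² − N (3n−2) |v|²`
  have hD : 0 ≤ ∑ i, ∑ j, ∑ k, (2 * (n - 1) * (n + 2) * t i j k - P i j k) ^ 2 :=
    Finset.sum_nonneg fun i _ ↦ Finset.sum_nonneg fun j _ ↦
      Finset.sum_nonneg fun k _ ↦ sq_nonneg _
  have hexp : ∀ i j k, (2 * (n - 1) * (n + 2) * t i j k - P i j k) ^ 2 =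
      (2 * (n - 1) * (n + 2)) ^ 2 * t i j k ^ 2
        - 2 * (2 * (n - 1) * (n + 2)) * (t i j k * P i j k) + P i j k * P i j k := by
    intro i j k; ring
  simp only [hexp, Finset.sum_add_distrib, Finset.sum_sub_distrib, ← Finset.mul_sum] at hD
  rw [htP, hPP, hvv, hv2] at hD
  -- `hD : 0 ≤ N² |t|² − 2N(3n−2)|v|² + (3n−2) N |v|²`
  have hkey : 2 * (n - 1) * (n + 2) * ((3 * n - 2) * ∑ i, v i ^ 2) ≤
      2 * (n - 1) * (n + 2) * (2 * (n - 1) * (n + 2) * ∑ i, ∑ j, ∑ k, t i j k ^ 2) := by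
    nlinarith [hD]
  -- case distinction on `n`
  rcases Nat.lt_or_ge (Fintype.card ι) 2 with hlt | hge
  · interval_cases h : Fintype.card ι
    · -- `ι` is empty
      haveI : IsEmpty ι := Fintype.card_eq_zero_iff.mp h
      simp
    · -- `n = 1`: the coefficient is `1/0 = 0`
      have h0 : 2 * (n - 1) * (n + 2) = 0 := by rw [hn]; norm_num
      rw [h0, div_zero, zero_mul]
      exact hsq
  · have hn2 : (2 : ℝ) ≤ n := by rw [hn]; exact_mod_cast hge
    have hNpos : 0 < 2 * (n - 1) * (n + 2) := by nlinarith
    rw [div_mul_eq_mul_div, div_le_iff₀ hNpos]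
    have := le_of_mul_le_mul_left hkey hNpos
    linarith

end Algebra

/-! ### Huisken's estimate `|∇Ric|² ≥ (3n−2)/(2(n−1)(n+2)) |∇S|²` -/

section Geometry

variable {E : Type*} [NormedAddCommGroup E] [NormedSpace ℝ E] [FiniteDimensional ℝ E]
  [CompleteSpace E]

namespace IsMetricOn

variable {G : E → E →L[ℝ] E →L[ℝ] ℝ} {V : Set E} {x : E} {ι : Type*} [Fintype ι]
  (b : Basis ι ℝ E)

/-- **`|∇Ric|²` in an orthonormal frame**: for any basis `b` and any `G x`-orthonormal basis `e`,
`Σ_{kl} g^{kl} ⟨∇_{b_k}Ric, ∇_{b_l}Ric⟩_G = Σ_{cij} ((∇_{e_c}Ric)(e_i,e_j))²` (the left side is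
the metric trace of the bilinear form `(Y,Z) ↦ ⟨∇_Y Ric, ∇_Z Ric⟩_G`, read in the frame `e`;
then Parseval for the symmetric forms `∇_{e_c}Ric`, `IsMetricOn.cov₂At_ricAt_symm`).
[cite: ONeill1983, Ch. 3, pp. 60–61] -/
theorem covNormSq_ricAt_eq_sum_frame (hG : IsMetricOn G V) (hx : x ∈ V) {κ : Type*} [Fintype κ]
    [DecidableEq κ] (e : Basis κ ℝ E) (he : ∀ c d, G x (e c) (e d) = if c = d then 1 else 0) :
    ∑ k, ∑ l, ginv G b x k l *
        pairAt G x (cov₂At G (ricAt G) x (b k)) (cov₂At G (ricAt G) x (b l)) =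
      ∑ c, ∑ i, ∑ j, cov₂At G (ricAt G) x (e c) (e i) (e j) ^ 2 := by
  have hi := hG.isInvertible x hx
  have hs := hG.symm x hx
  -- the bilinear form `(Y,Z) ↦ ⟨∇_Y Ric, ∇_Z Ric⟩_G`
  let Φ : E →ₗ[ℝ] E →ₗ[ℝ] ℝ := LinearMap.mk₂ ℝ
    (fun u w ↦ pairAt G x (cov₂At G (ricAt G) x u) (cov₂At G (ricAt G) x w))
    (fun u u' w ↦ by simp only [map_add, pairAt_add_left])
    (fun c u w ↦ by simp only [map_smul, pairAt_smul_left, smul_eq_mul])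
    (fun u w w' ↦ by simp only [map_add, pairAt_add_right])
    (fun c u w ↦ by simp only [map_smul, pairAt_smul_right, smul_eq_mul])
  have h := sum_ginv_smul_eq_sum_frame b e he hi hs Φ
  simp only [Φ, LinearMap.mk₂_apply, smul_eq_mul] at h
  rw [h]
  refine Finset.sum_congr rfl fun c _ ↦ ?_
  rw [pairAt_self_of_symm G x (hG.cov₂At_ricAt_symm hx (e c)),
    normSqAt_eq_sum_frame e he hi hs]

/-- **Huisken 1985, Lemma 4.3 / Hamilton 1982, Lemma 11.6**:
`(3n−2)/(2(n−1)(n+2)) |∇S|² ≤ |∇Ric|²` at a positive definite point (`n = dim E`), from the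
contracted Bianchi identity `dS = 2 div Ric` (`IsMetricOn.fderiv_scalAt`). In a `G x`-orthonormal
frame `e`, `T_{ijk} = (∇_{e_i}Ric)(e_j,e_k)` is symmetric in `(j,k)`, `Σ_j T_{ijj} = dS(e_i)`
(`tr_G ∇_Y Ric = dS(Y)`, `IsMetricOn.fderiv_scalAt_eq_mtrAt`) and `Σ_i T_{iik} = dS(e_k)/2`
(`IsMetricOn.fderiv_scalAt'`); the estimate is then the Kronecker algebra `sum_sq_traces_le`.
[cite: Huisken1985, Lemma 4.3] -/
theorem mul_gradSqAt_scalAt_le_covNormSq_ricAt (hG : IsMetricOn G V) (hx : x ∈ V)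
    (hpos : ∀ v : E, v ≠ 0 → 0 < G x v v) :
    (3 * (finrank ℝ E : ℝ) - 2) / (2 * ((finrank ℝ E : ℝ) - 1) * ((finrank ℝ E : ℝ) + 2))
        * gradSqAt G (scalAt G) x
      ≤ ∑ k, ∑ l, ginv G b x k l *
          pairAt G x (cov₂At G (ricAt G) x (b k)) (cov₂At G (ricAt G) x (b l)) := by
  have hi := hG.isInvertible x hx
  have hs := hG.symm x hx
  obtain ⟨e, he⟩ := exists_orthonormal_basis hs hpos
  rw [hG.covNormSq_ricAt_eq_sum_frame b hx e he, gradSqAt_eq_sum_frame e he hi hs]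
  -- the two trace identities
  have h₁ : ∀ i, ∑ j, cov₂At G (ricAt G) x (e i) (e j) (e j) =
      fderiv ℝ (scalAt G) x (e i) := by
    intro i
    rw [hG.fderiv_scalAt_eq_mtrAt hx, mtrAt_eq_sum_frame e he hi]
  have h₂ : ∀ k, ∑ i, cov₂At G (ricAt G) x (e i) (e i) (e k) =
      fderiv ℝ (scalAt G) x (e k) / 2 := by
    intro k
    rw [hG.fderiv_scalAt' e hx (e k)]
    simp only [ginv_of_orthonormal e he hi, ite_mul, one_mul, zero_mul, Finset.sum_ite_eq,
      Finset.mem_univ, if_true]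
    ring
  have h := sum_sq_traces_le (fun i j k ↦ cov₂At G (ricAt G) x (e i) (e j) (e k))
    (fun i ↦ fderiv ℝ (scalAt G) x (e i))
    (fun i j k ↦ hG.cov₂At_ricAt_symm hx (e i) (e j) (e k)) h₁ h₂
  simpa only [Fintype.card_fin] using h

end IsMetricOn

end Geometry

end MetricCoord

end Literature.Geometry.Lorentzian

end
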